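import Literature.MathematicalPhysics.QuantumFieldTheory.Balaban1983to89.B9Thm311CoercivePureGaugeAtLettersY
import Literature.MathematicalPhysics.QuantumFieldTheory.Balaban1983to89.B9Thm311PrincipalAtLettersR

/-!
# `Balaban1983to89.B9Thm311PureGaugeClassAtLettersR` — row 17 of the N06 knit ([B9] Theorem 3.11) IS A THEOREM ON THE CLASS OF PURE GAUGES:
# the named inhabitant of the member-local binders of `t311_of_pins_opsYOfLettersV4₁R` ∕ `t311_of_pins_principalR` (STANDING A6 RULE), and the
# A6 ledger of rows 15–17

T. Bałaban, *Propagators for lattice gauge theories in a background field*, Commun. Math. Phys. **99** (1985) 389–434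
[`Balaban1985BackgroundPropagators`, "B9"]; [4] = T. Bałaban, *Propagators and renormalization transformations for lattice gauge theories. II*,
Commun. Math. Phys. **96** (1984) 223–250.

statement-level skeleton of published theorems with citation tags; proofs where landed; nothing here is a claim about the
Yang–Mills mass gap

THE PRINTED LOCI (verbatim).  p. 416, Theorem 3.11: *"Under the assumptions of the Theorems 3.1–3.10 (i.e. for M sufficiently large and α₀ sufficiently
small) the operators Δ′_a, G′, (Q′G′²Q′\*)⁻¹, Δ_a, G are positive definite. … In [4] we have proved that the operator G_□(1) is positive"*;  p. 395:
*"It coincides with Δ_a in (2.19) if U = 1"*;  p. 396, (3.34)–(3.35): the classes of backgrounds are unions of gauge orbits (*"U^u … u an arbitrary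
gauge transformation"*), and *"Δ_a(U^u) = R(u)Δ_a(U)R(u⁻¹)"*.

WHY THIS FILE (cell context).  The director's STANDING A6 RULE (pub-ymgap №189 (3), 2026-08-27): *every junction ∕ knit lemma whose hypotheses are
member-local binders ships a satisfiability witness — `example : ∃ …, <the binders>` or a named inhabitant — or says why the binders are inhabited*.
This lineage's row-17 faces at generic class parameters `(R₁, R₂)` — `B9Thm39Thm311AtLettersR.t311_of_pins_opsYOfLettersV4₁R` (binders `hG`, `hΔA`,
`hPD`) and `B9Thm311PrincipalAtLettersR.t311_of_pins_principalR` (binders `hG`, `hplaq`, `hcoer`, `hγ`, `hPD`) — were filed (gen 12) without one.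
THIS FILE supplies the honest inhabitant the tree affords, the class of PURE GAUGES `R₁ := pureGaugeFamY` («U = 1^u, u SU(N)-valued»; non-empty at
every member: `one_mem_pureGaugeFamY`), and the two consequences:
* ★★ `t311_pureGaugeR` — `B9.Thm311Printed c35Y geo9Y (bg9YR (M_N(ℂ)) SU(N) pureGaugeFamY R₂) (fun x => (ops x).PosDef)` at `ops := opsYOfLetters N θ M⋆
  (lettersYOfRecordV4 …) 𝔈` FROM THE POSITIVITY PIN `hPD` ALONE: on the pure-gauge class Theorem 3.11 AS TYPED BY THE CERTIFICATE holds — every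
  binder of the gen-12 face other than the pin is DISCHARGED there (`hG`: `memOfFam_pureGaugeFamY`; `hΔA`: `hΔA_pureGaugeFamY` = gen 10's
  `posDefTr_deltaAY_parSymY_pureGauge`);
* ★★★ `t311_pureGaugeR_pinned` — the same with the expansion letters' `PosDef` field PINNED (`pinPosDef311 θ M⋆ 𝔯 𝔈 := 𝔈 with PosDef :=
  PosDefOfOps (ops311Y …)`, so `hPD` is `rfl`): ZERO HYPOTHESES.  At def-Y's genuine letters, for every member of Stage 3′(Y) and every pure gauge `U`,
  the five operators Δ′_a(U), G′(U), (Q′G′²Q′\*)⁻¹(U), Δ_a(U), G(U) of Theorem 3.11 are positive definite (print: «for U = 1 proved in [4]» + (3.34));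
* ★★ `t311_pureGaugeR_via_principal` — the PRINCIPAL face `t311_of_pins_principalR` inhabited on the same class: δ := 0 (`plaq_pureGaugeFamY`: a pure
  gauge is flat), γ := the per-member constant of `B9Thm311CoercivePureGaugeAtLettersY.exists_principal_coer_pureGauge` (`hcoer_pureGaugeFamY`), `hγ`
  reduces to `0 < γ x`;  `binders_t311R_inhabited` ∕ `binders_principalR_inhabited` — the binder conjunctions as `∃`-statements, for mechanical reading.

A6 LEDGER OF ROWS 15–17 (this lineage's faces; what is a pin, what is a reading, what is print's analysis).
* Row 17 (`t311_of_pins_opsYOfLettersV4₁R`, `t311_of_pins_principalR`, and their print-class instances `_P`):  `hPD` — a PIN on the free letter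
  `𝔈.PosDef` (`(opsYOfLetters … 𝔈 x).PosDef = (𝔈 x).PosDef` definitionally), inhabited by `pinPosDef311` (`posDef_pinPosDef311`, `rfl`);  `hG` — «R₁-members
  are SU(N)-valued», a theorem at print's class (`memOfFam_regYP335`) and at the pure-gauge class (`memOfFam_pureGaugeFamY`);  `hΔA` ∕ (`hplaq`, `hcoer`,
  `hγ`) — PRINT's ANALYSIS (Theorem 3.11's proof: Theorem 3.3 ∕ [4]'s volume-uniform coercivity + (3.35)): THEOREMS on the pure-gauge class (this file);
  at print's class (3.35) `hplaq` is a theorem (`plaq_le_of_regYP335`) and `hcoer` with a volume-UNIFORM γ is [4]'s content — displayed, NOT witnessed by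
  the tree (the NE9 chain's `B9Thm311SmallFieldCoercivityUniform` proves the mechanism at other letters, one averaging level).  NOT contradictory: the
  binder family is inhabited at `R₁ := pureGaugeFamY` with the SAME `hPD`, `θ`, `M⋆`, `𝔯`, `𝔈`, `R₂`.
* Rows 15–16 (`t39_hksum_of_pins_opsYOfLettersR` and `_P`):  `hC`, `hblk`, `hL`, `hEK39` — PINS (letters of record ∕ the free letter `𝔈.EK39`);
  `𝔬39`, `rd39`, `hst`, `hloc` — the READING and its static bookkeeping (inhabited by the reading of record, `B9Thm39ReadingAtLetters` ∕ n06-i's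
  `B9Thm39ReadingFaithful`);  `h39 : … Reg335 … U → Local348Blk ∧ Identities395Blk ∧ Small285Blk ∧ Factors389Blk` — PRINT's ANALYSIS (Theorems 3.1–3.2:
  exponential localisation of the cube inverses, the small remainder (2.85), the factor bounds (3.89)): the tree holds NO non-vacuous inhabitant at
  def-Y's letters (it is inhabited vacuously at the empty class `R₁ := fun _ _ _ _ => False`, which certifies consistency of the binder family and
  nothing else) — said here so that no reader mistakes the absence for an oversight.
HONEST SCOPE.  The inhabitant lives on the TRIVIAL gauge orbit, not on print's class (3.35): it certifies that the row-17 faces are consistent and that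
Theorem 3.11 as typed is an outright theorem there; it does NOT discharge row 17 at the class of record (whose displayed input remains Theorem 3.3 ∕ [4]'s
uniform coercivity); nothing of [B9] or [4] is asserted; NOT a node discharge, NOT summit progress; count-neutral; one finite 𝕋⁴ programme — nothing
continuum, nothing about the mass gap.  Cell `pub-ymgap` (HUMAN RULING D-0062), Track A node N06 [B9], seat `pub-ymgap-dag-n06-j` (harness re-seat
gen 13), 2026-08-27.  No `sorry`, no `axiom`, no `instance`, no `notation`; two `def`s (`pureGaugeFamY`, `pinPosDef311`).
-/

namespace Literature.MathematicalPhysics.QuantumFieldTheory.Balaban1983to89.B9Thm311PureGaugeClassAtLettersR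

open Literature.MathematicalPhysics.QuantumFieldTheory.Balaban1983to89
open B9Thm311Whole B9Thm311ReadingCoords B9Thm311ReadingAtLetters B9Thm311SymmAtRecordV4 B9Thm311PosAtRecordV4 B9Thm311ProjectionR
  B9Thm311DeltaPrimePos B9Thm311PosOfPrincipalAtLettersY B9Eq335CoveragePAtLettersY B9Thm39Thm311AtLettersR B9Thm311PrincipalAtLettersR
  B9Thm311DeltaAGaugeOrbit B9Thm311CoercivePureGaugeAtLettersY Node00
open B6KLevelCensusIndexV1 B6GlobalChartV1 B9BackgroundsKLevelV1 B9PinMembersKLevelV1 B9PinCarriersKLevelV1 B9PinGeometryKLevelV1 B7Prop2SpecialUnitary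
open B9BackgroundsKLevelV1R B9BackgroundsKLevelV1P
open scoped Matrix

noncomputable section

/-! ## §1 The class of pure gauges as a regularity family `R₁` -/

section Family

variable {d ℓ : ℕ} {hd : 1 ≤ d + 1} {hL : Odd (ℓ + 1) ∧ 1 < ℓ + 1} {b₀ b₁ : ℝ} {Mstar : ℕ}
variable (𝔸 : Type) [NormedRing 𝔸] [NormedAlgebra ℂ 𝔸] [CompleteSpace 𝔸] (G : Subgroup 𝔸ˣ)

/-- **THE CLASS OF PURE GAUGES** as a regularity family on the members (the slot `R₁` of `bg9YR`): at a member `x`, for any constant `c` and any `α₀`,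
`U` is in the class iff `U = 1^u` for some `G`-valued gauge transformation `u` of the member's torus — the gauge orbit of the trivial background
((3.28), (3.34)), the sub-class of every class (3.35) on which print's «for U = 1 … proved in [4]» applies verbatim.
[cite: Balaban1985BackgroundPropagators, (3.28) p.395, (3.34)–(3.35) p.396, Thm 3.11 p.416] -/
def pureGaugeFamY : RegFamY d ℓ hd hL b₀ b₁ Mstar 𝔸 :=
  fun x _ _ U => ∃ u : GaugeY 𝔸 x.toKIdx, (∀ y, u y ∈ G) ∧ U = gaugeY x.toKIdx u (fun _ _ => 1)

variable {𝔸 G}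

/-- members of the pure-gauge class are `G`-valued (the binder `hG` of the row-17 faces, discharged on this class).
[cite: Balaban1985BackgroundPropagators, (3.28) p.395, bookkeeping] -/
theorem memOfFam_pureGaugeFamY : MemOfFam G (pureGaugeFamY (d := d) (ℓ := ℓ) (hd := hd) (hL := hL) (b₀ := b₀) (b₁ := b₁) (Mstar := Mstar) 𝔸 G) := by
  rintro x c α₀ U ⟨u, hu, rfl⟩ μ y
  exact gaugeY_one_mem x.toKIdx hu μ y

/-- **the class is NON-EMPTY at every member**: the trivial background `U = 1 = 1^1` belongs to it (so the `∀ U ∈ R₁` of the faces is never vacuous).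
[cite: Balaban1985BackgroundPropagators, p.395 («if U = 1»), bookkeeping] -/
theorem one_mem_pureGaugeFamY (x : MemberY d ℓ hd hL b₀ b₁ Mstar) (c α₀ : ℝ) :
    pureGaugeFamY 𝔸 G x c α₀ (fun _ _ => 1 : CfgY 𝔸 x.toKIdx) := by
  refine ⟨1, fun _ => G.one_mem, funext fun μ => funext fun y => ?_⟩
  rw [gaugeY_apply, Pi.one_apply, Pi.one_apply, one_mul, inv_one, mul_one]

/-- members of the pure-gauge class are FLAT: every plaquette variable is `1`. [cite: Balaban1985BackgroundPropagators, (3.2) p.390, (3.28) p.395] -/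
theorem flat_of_pureGaugeFamY {x : MemberY d ℓ hd hL b₀ b₁ Mstar} (c α₀ : ℝ) {U : CfgY 𝔸 x.toKIdx} (hU : pureGaugeFamY 𝔸 G x c α₀ U)
    (p : PlaqY x.toKIdx) : holY x.toKIdx U p = 1 := by
  obtain ⟨u, -, rfl⟩ := hU
  exact holY_gaugeY_one x.toKIdx u p

end Family

/-! ## §2 Row 17's displayed binders HOLD on the pure-gauge class (`𝔸 = M_N(ℂ)`, `G = SU(N)`) -/

section Binders

open scoped Matrix.Norms.L2Operator

variable {d ℓ : ℕ} {hd : 1 ≤ d + 1} {hL : Odd (ℓ + 1) ∧ 1 < ℓ + 1} {b₀ b₁ : ℝ} {Mstar N : ℕ}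

/-- ★ **`hΔA` ON THE PURE-GAUGE CLASS**: `Δ_a(U)` is positive definite at every member of the class — gen 10's `posDefTr_deltaAY_parSymY_pureGauge`
(`U = 1` by [4], transported by (3.34)). [cite: Balaban1985BackgroundPropagators, Thm 3.11 p.416, (3.34) p.396] -/
theorem hΔA_pureGaugeFamY (x : MemberY d ℓ hd hL b₀ b₁ Mstar) (c α₀ : ℝ) {U : CfgY (Matrix (Fin N) (Fin N) ℂ) x.toKIdx}
    (hU : pureGaugeFamY (Matrix (Fin N) (Fin N) ℂ) (specialUnitaryUnits (Fin N)) x c α₀ U) :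
    PosDefTr (fun _ => (1 : ℝ)) (deltaAY x.toKIdx (parSymY x.toKIdx) (parBY x.toKIdx) (GpY x.toKIdx (parSymY x.toKIdx)) U) := by
  obtain ⟨u, hu, rfl⟩ := hU
  exact posDefTr_deltaAY_parSymY_pureGauge x.toKIdx fun y => specialUnitaryUnits_le_unitaryUnits (hu y)

/-- **`hplaq` ON THE PURE-GAUGE CLASS WITH δ = 0**: `‖U(∂p) − 1‖ ≦ 0`. [cite: Balaban1985BackgroundPropagators, (3.2) p.390, (3.69) p.404 (plaquette variables)] -/
theorem plaq_pureGaugeFamY (x : MemberY d ℓ hd hL b₀ b₁ Mstar) (c α₀ : ℝ) {U : CfgY (Matrix (Fin N) (Fin N) ℂ) x.toKIdx}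
    (hU : pureGaugeFamY (Matrix (Fin N) (Fin N) ℂ) (specialUnitaryUnits (Fin N)) x c α₀ U) (p : PlaqY x.toKIdx) :
    ‖((holY x.toKIdx U p : (Matrix (Fin N) (Fin N) ℂ)ˣ) : Matrix (Fin N) (Fin N) ℂ) - 1‖ ≤ 0 := by
  rw [flat_of_pureGaugeFamY c α₀ hU p, Units.val_one, sub_self, norm_zero]

/-- ★ **`hcoer` ON THE PURE-GAUGE CLASS**: one constant `γ > 0` per member bounds the principal gauge-fixed form from below at EVERY pure gauge —
`B9Thm311CoercivePureGaugeAtLettersY.exists_principal_coer_pureGauge`. [cite: Balaban1985BackgroundPropagators, (3.26) p.395, (3.34) p.396, Thm 3.11 p.416] -/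
theorem hcoer_pureGaugeFamY (x : MemberY d ℓ hd hL b₀ b₁ Mstar) :
    ∃ γ : ℝ, 0 < γ ∧ ∀ (c α₀ : ℝ) (U : CfgY (Matrix (Fin N) (Fin N) ℂ) x.toKIdx),
      pureGaugeFamY (Matrix (Fin N) (Fin N) ℂ) (specialUnitaryUnits (Fin N)) x c α₀ U →
        ∀ A : FBondY x.toKIdx → Matrix (Fin N) (Fin N) ℂ,
          γ * trIP (fun _ => (1 : ℝ)) A A ≤ trIP (fun _ => (1 : ℝ)) (curlY x.toKIdx U A) (curlY x.toKIdx U A)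
            + trIP (fun _ => (1 : ℝ)) (divY x.toKIdx U A)
                (RY x.toKIdx (parSymY x.toKIdx) (GpY x.toKIdx (parSymY x.toKIdx)) U (divY x.toKIdx U A))
            + trIP x.w (QY x.toKIdx (parBY x.toKIdx) U A) (QY x.toKIdx (parBY x.toKIdx) U A) := by
  obtain ⟨γ, hγ, h⟩ := exists_principal_coer_pureGauge (N := N) x.toKIdx specialUnitaryUnits_le_unitaryUnits
  refine ⟨γ, hγ, ?_⟩
  rintro c α₀ U ⟨u, hu, rfl⟩ A
  exact h u hu A

end Binders

/-! ## §3 Row 17 IS A THEOREM on the pure-gauge class: from the pin alone, and with the pin built in -/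

section Row17

open scoped Matrix.Norms.L2Operator

variable {N : ℕ} (θ : Stage3Params) (Mstar : ℕ) (𝔯 : ResY N θ Mstar) (𝔈 : ExpsY N θ Mstar)
variable (R₂ : RegFamY θ.d₆ θ.ℓ₆ θ.hd' θ.hL' θ.b₀ θ.b₁ Mstar (Matrix (Fin N) (Fin N) ℂ))

/-- ★★ **ROW 17 ON THE PURE-GAUGE CLASS FROM THE PIN ALONE**: with `R₁ := pureGaugeFamY` (and any `R₂`), Theorem 3.11 as typed by the certificate,
`B9.Thm311Printed c35Y geo9Y (bg9YR (M_N(ℂ)) SU(N) pureGaugeFamY R₂) (fun x => ((opsYOfLetters N θ M⋆ (lettersYOfRecordV4 …) 𝔈) x).PosDef)`, follows from the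
positivity pin `hPD` — gen 12's `t311_of_pins_opsYOfLettersV4₁R` with `hG := memOfFam_pureGaugeFamY`, `hΔA := hΔA_pureGaugeFamY`, `a₁ = M₁ = 1`.  The NAMED
INHABITANT of that face's binders (A6). [cite: Balaban1985BackgroundPropagators, Thm 3.11 p.416, (3.34) p.396] -/
theorem t311_pureGaugeR
    (hPD : ∀ x : MemberY θ.d₆ θ.ℓ₆ θ.hd' θ.hL' θ.b₀ θ.b₁ Mstar,
      ((opsYOfLetters N θ Mstar (lettersYOfRecordV4 N θ Mstar 𝔯) 𝔈) x).PosDef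
        = PosDefOfOps (ops311Y x (lettersYOfRecordV4 N θ Mstar 𝔯 x) (proofLettersOneV4 θ Mstar 𝔯 x))) :
    B9.Thm311Printed c35Y geo9Y
      (bg9YR (Matrix (Fin N) (Fin N) ℂ) (specialUnitaryUnits (Fin N))
        (pureGaugeFamY (Matrix (Fin N) (Fin N) ℂ) (specialUnitaryUnits (Fin N))) R₂)
      (fun x => ((opsYOfLetters N θ Mstar (lettersYOfRecordV4 N θ Mstar 𝔯) 𝔈) x).PosDef) :=
  t311_of_pins_opsYOfLettersV4₁R θ Mstar 𝔯 𝔈 (pureGaugeFamY (Matrix (Fin N) (Fin N) ℂ) (specialUnitaryUnits (Fin N))) R₂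
    memOfFam_pureGaugeFamY 1 1 one_pos one_pos (fun x _ α₀ _ _ _ hU => hΔA_pureGaugeFamY x c35Y α₀ hU) hPD

/-- **THE EXPANSION LETTERS WITH THE POSITIVITY LETTER PINNED**: `𝔈` with its free field `PosDef` replaced by the genuine positivity of the five operators
of Theorem 3.11 at def-Y's v4 letters, `PosDefOfOps (ops311Y x (lettersYOfRecordV4 …) (proofLettersOneV4 …))` — the datum at which the pin `hPD` is `rfl`.
[cite: Balaban1985BackgroundPropagators, Thm 3.11 p.416, (3.24)–(3.27) pp.394–395 (the five operators)] -/
def pinPosDef311 : ExpsY N θ Mstar := fun x =>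
  { 𝔈 x with PosDef := PosDefOfOps (ops311Y x (lettersYOfRecordV4 N θ Mstar 𝔯 x) (proofLettersOneV4 θ Mstar 𝔯 x)) }

/-- at the pinned letters the positivity pin `hPD` holds by `rfl` (for ANY covariant letters `𝔏`: the layer's `PosDef` IS `𝔈`'s).
[cite: Balaban1985BackgroundPropagators, Thm 3.11 p.416, bookkeeping] -/
theorem posDef_pinPosDef311 (𝔏 : LettersY N θ Mstar) (x : MemberY θ.d₆ θ.ℓ₆ θ.hd' θ.hL' θ.b₀ θ.b₁ Mstar) :
    ((opsYOfLetters N θ Mstar 𝔏 (pinPosDef311 θ Mstar 𝔯 𝔈)) x).PosDef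
      = PosDefOfOps (ops311Y x (lettersYOfRecordV4 N θ Mstar 𝔯 x) (proofLettersOneV4 θ Mstar 𝔯 x)) := rfl

/-- ★★★ **ROW 17 ON THE PURE-GAUGE CLASS, ZERO HYPOTHESES**: at def-Y's genuine letters with the positivity letter pinned, Theorem 3.11 as typed by the
certificate HOLDS on `R₁ := pureGaugeFamY`: for every member of Stage 3′(Y) (M ≧ 1), every `α₀ ∈ (0, 1∕M]` and every pure gauge `U = 1^u` (u SU(N)-valued)
the five operators Δ′_a(U), G′(U), (Q′G′²Q′\*)⁻¹(U), Δ_a(U), G(U) read by `PosDefOfOps (ops311Y …)` are positive definite — print's «for U = 1 … proved in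
[4]» + (3.34), at the record. [cite: Balaban1985BackgroundPropagators, Thm 3.11 p.416, p.395 («if U = 1»), (3.34) p.396; Balaban1984PropagatorsII, p.228] -/
theorem t311_pureGaugeR_pinned :
    B9.Thm311Printed c35Y geo9Y
      (bg9YR (Matrix (Fin N) (Fin N) ℂ) (specialUnitaryUnits (Fin N))
        (pureGaugeFamY (Matrix (Fin N) (Fin N) ℂ) (specialUnitaryUnits (Fin N))) R₂)
      (fun x => ((opsYOfLetters N θ Mstar (lettersYOfRecordV4 N θ Mstar 𝔯) (pinPosDef311 θ Mstar 𝔯 𝔈)) x).PosDef) :=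
  t311_pureGaugeR θ Mstar 𝔯 (pinPosDef311 θ Mstar 𝔯 𝔈) R₂ fun _ => rfl

/-- ★★ **ROW 17 ON THE PURE-GAUGE CLASS VIA THE PRINCIPAL FACE**: gen 12's `t311_of_pins_principalR` with ALL its analytic binders inhabited — `hG :=
memOfFam_pureGaugeFamY`, `δ := 0` with `hplaq := plaq_pureGaugeFamY`, `γ` and `hcoer` from `hcoer_pureGaugeFamY` (one constant per member, uniform on the
orbit), `hγ : 12(d+1)c_f²·0 < (1 − 0)·γ x` from `0 < γ x` — leaving the pin `hPD`.  The NAMED INHABITANT of the principal face's binders (A6).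
[cite: Balaban1985BackgroundPropagators, Thm 3.11 p.416, (3.26) p.395, (3.34) p.396] -/
theorem t311_pureGaugeR_via_principal
    (hPD : ∀ x : MemberY θ.d₆ θ.ℓ₆ θ.hd' θ.hL' θ.b₀ θ.b₁ Mstar,
      ((opsYOfLetters N θ Mstar (lettersYOfRecordV4 N θ Mstar 𝔯) 𝔈) x).PosDef
        = PosDefOfOps (ops311Y x (lettersYOfRecordV4 N θ Mstar 𝔯 x) (proofLettersOneV4 θ Mstar 𝔯 x))) :
    B9.Thm311Printed c35Y geo9Y
      (bg9YR (Matrix (Fin N) (Fin N) ℂ) (specialUnitaryUnits (Fin N))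
        (pureGaugeFamY (Matrix (Fin N) (Fin N) ℂ) (specialUnitaryUnits (Fin N))) R₂)
      (fun x => ((opsYOfLetters N θ Mstar (lettersYOfRecordV4 N θ Mstar 𝔯) 𝔈) x).PosDef) := by
  choose γ hγ hcoer using fun x : MemberY θ.d₆ θ.ℓ₆ θ.hd' θ.hL' θ.b₀ θ.b₁ Mstar => hcoer_pureGaugeFamY (N := N) x
  exact t311_of_pins_principalR θ Mstar 𝔯 𝔈 (pureGaugeFamY (Matrix (Fin N) (Fin N) ℂ) (specialUnitaryUnits (Fin N))) R₂
    memOfFam_pureGaugeFamY 1 1 one_pos one_pos (δ := 0) le_rfl zero_le_one γ (fun x _ α₀ _ _ _ hU p => plaq_pureGaugeFamY x c35Y α₀ hU p)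
    (fun x _ α₀ _ _ U hU A => hcoer x c35Y α₀ U hU A) (fun x => by rw [mul_zero, sub_zero, one_mul]; exact hγ x) hPD

end Row17

/-! ## §4 The binder conjunctions as `∃`-statements (STANDING A6 RULE, mechanical reading) -/

section A6

open scoped Matrix.Norms.L2Operator

variable {N : ℕ} (θ : Stage3Params) (Mstar : ℕ)

/-- **A6 — THE BINDERS OF `t311_of_pins_opsYOfLettersV4₁R` ARE JOINTLY INHABITED** by a class that is non-empty at every member: `∃ R₁` with «members
SU(N)-valued» (`hG`), «`1 ∈ R₁` at every member», and the displayed clause `hΔA` for EVERY threshold pair `(a₁, M₁)`;  the pin `hPD` is inhabited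
separately by `posDef_pinPosDef311`. [cite: Balaban1985BackgroundPropagators, Thm 3.11 p.416, (3.34) p.396] -/
theorem binders_t311R_inhabited (R₂ : RegFamY θ.d₆ θ.ℓ₆ θ.hd' θ.hL' θ.b₀ θ.b₁ Mstar (Matrix (Fin N) (Fin N) ℂ)) :
    ∃ R₁ : RegFamY θ.d₆ θ.ℓ₆ θ.hd' θ.hL' θ.b₀ θ.b₁ Mstar (Matrix (Fin N) (Fin N) ℂ),
      MemOfFam (specialUnitaryUnits (Fin N)) R₁ ∧
      (∀ (x : MemberY θ.d₆ θ.ℓ₆ θ.hd' θ.hL' θ.b₀ θ.b₁ Mstar) (c α₀ : ℝ), R₁ x c α₀ (fun _ _ => 1)) ∧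
      ∀ a₁ M₁ : ℝ, ∀ x : MemberY θ.d₆ θ.ℓ₆ θ.hd' θ.hL' θ.b₀ θ.b₁ Mstar, M₁ ≤ (geo9Y x).M → ∀ α₀ : ℝ, 0 < α₀ → (geo9Y x).M * α₀ ≤ a₁ →
        ∀ U : (bg9YR (Matrix (Fin N) (Fin N) ℂ) (specialUnitaryUnits (Fin N)) R₁ R₂ x).Cfg,
          (bg9YR (Matrix (Fin N) (Fin N) ℂ) (specialUnitaryUnits (Fin N)) R₁ R₂ x).Reg335 c35Y α₀ U →
            PosDefTr (fun _ => (1 : ℝ))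
              (deltaAY x.toKIdx (parSymY x.toKIdx) (parBY x.toKIdx) (GpY x.toKIdx (parSymY x.toKIdx)) U) :=
  ⟨pureGaugeFamY (Matrix (Fin N) (Fin N) ℂ) (specialUnitaryUnits (Fin N)), memOfFam_pureGaugeFamY,
    fun x c α₀ => one_mem_pureGaugeFamY x c α₀, fun _ _ x _ α₀ _ _ _ hU => hΔA_pureGaugeFamY x c35Y α₀ hU⟩

/-- **A6 — THE BINDERS OF `t311_of_pins_principalR` ARE JOINTLY INHABITED** (non-empty class, `δ := 0 ∈ [0, 1]`, one `γ` per member): `∃ R₁ γ` with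
`hG`, «`1 ∈ R₁`», `hplaq` (δ = 0), `hcoer`, and `hγ` for EVERY `(a₁, M₁)`. [cite: Balaban1985BackgroundPropagators, Thm 3.11 p.416, (3.26) p.395, (3.34) p.396] -/
theorem binders_principalR_inhabited (R₂ : RegFamY θ.d₆ θ.ℓ₆ θ.hd' θ.hL' θ.b₀ θ.b₁ Mstar (Matrix (Fin N) (Fin N) ℂ)) :
    ∃ (R₁ : RegFamY θ.d₆ θ.ℓ₆ θ.hd' θ.hL' θ.b₀ θ.b₁ Mstar (Matrix (Fin N) (Fin N) ℂ))
      (γ : MemberY θ.d₆ θ.ℓ₆ θ.hd' θ.hL' θ.b₀ θ.b₁ Mstar → ℝ),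
      MemOfFam (specialUnitaryUnits (Fin N)) R₁ ∧
      (∀ (x : MemberY θ.d₆ θ.ℓ₆ θ.hd' θ.hL' θ.b₀ θ.b₁ Mstar) (c α₀ : ℝ), R₁ x c α₀ (fun _ _ => 1)) ∧
      (∀ a₁ M₁ : ℝ, ∀ x : MemberY θ.d₆ θ.ℓ₆ θ.hd' θ.hL' θ.b₀ θ.b₁ Mstar, M₁ ≤ (geo9Y x).M → ∀ α₀ : ℝ, 0 < α₀ → (geo9Y x).M * α₀ ≤ a₁ →
        ∀ U : (bg9YR (Matrix (Fin N) (Fin N) ℂ) (specialUnitaryUnits (Fin N)) R₁ R₂ x).Cfg,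
          (bg9YR (Matrix (Fin N) (Fin N) ℂ) (specialUnitaryUnits (Fin N)) R₁ R₂ x).Reg335 c35Y α₀ U →
            ∀ p : PlaqY x.toKIdx, ‖((holY x.toKIdx U p : (Matrix (Fin N) (Fin N) ℂ)ˣ) : Matrix (Fin N) (Fin N) ℂ) - 1‖ ≤ 0) ∧
      (∀ a₁ M₁ : ℝ, ∀ x : MemberY θ.d₆ θ.ℓ₆ θ.hd' θ.hL' θ.b₀ θ.b₁ Mstar, M₁ ≤ (geo9Y x).M → ∀ α₀ : ℝ, 0 < α₀ → (geo9Y x).M * α₀ ≤ a₁ →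
        ∀ U : (bg9YR (Matrix (Fin N) (Fin N) ℂ) (specialUnitaryUnits (Fin N)) R₁ R₂ x).Cfg,
          (bg9YR (Matrix (Fin N) (Fin N) ℂ) (specialUnitaryUnits (Fin N)) R₁ R₂ x).Reg335 c35Y α₀ U →
            ∀ A : FBondY x.toKIdx → Matrix (Fin N) (Fin N) ℂ,
              γ x * trIP (fun _ => (1 : ℝ)) A A ≤ trIP (fun _ => (1 : ℝ)) (curlY x.toKIdx U A) (curlY x.toKIdx U A)
                + trIP (fun _ => (1 : ℝ)) (divY x.toKIdx U A)
                    (RY x.toKIdx (parSymY x.toKIdx) (GpY x.toKIdx (parSymY x.toKIdx)) U (divY x.toKIdx U A))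
                + trIP x.w (QY x.toKIdx (parBY x.toKIdx) U A) (QY x.toKIdx (parBY x.toKIdx) U A)) ∧
      ∀ x : MemberY θ.d₆ θ.ℓ₆ θ.hd' θ.hL' θ.b₀ θ.b₁ Mstar, 12 * (θ.d₆ + 1) * x.cf ^ 2 * (0 : ℝ) < (1 - 0) * γ x := by
  choose γ hγ hcoer using fun x : MemberY θ.d₆ θ.ℓ₆ θ.hd' θ.hL' θ.b₀ θ.b₁ Mstar => hcoer_pureGaugeFamY (N := N) x
  exact ⟨pureGaugeFamY (Matrix (Fin N) (Fin N) ℂ) (specialUnitaryUnits (Fin N)), γ, memOfFam_pureGaugeFamY,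
    fun x c α₀ => one_mem_pureGaugeFamY x c α₀, fun _ _ x _ α₀ _ _ _ hU p => plaq_pureGaugeFamY x c35Y α₀ hU p,
    fun _ _ x _ α₀ _ _ U hU A => hcoer x c35Y α₀ U hU A, fun x => by rw [mul_zero, sub_zero, one_mul]; exact hγ x⟩

end A6

end

end Literature.MathematicalPhysics.QuantumFieldTheory.Balaban1983to89.B9Thm311PureGaugeClassAtLettersR
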